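import Summits.SmoothPoincare4.SmoothPoincare4.Theses.SullivanDual
import Summits.SmoothPoincare4.SmoothPoincare4.Theorems.SullivanDualHyperbolicEndSPC4Case
import Summits.SmoothPoincare4.SmoothPoincare4.Theorems.SullivanDualHyperbolicEndTaubesModelDefs
import Summits.SmoothPoincare4.SmoothPoincare4.Theorems.SullivanDualHyperbolicEndStubNoWitnessOffDefect
import Summits.SmoothPoincare4.SmoothPoincare4.Theorems.SullivanDualHyperbolicEndStubNearSymplecticData
import Literature.Geometry.Symplectic.GromovMcDuffTwistedSphereProofs
import Literature.Geometry.Symplectic.JPlanePencilLocalFamily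
import Literature.Geometry.Symplectic.JHolomorphicMap

/-!
# Line `taubes-circle-pencil` — skeleton for crux `SullivanDual.HyperbolicEnd` (stmt-SmoothPoincare4-7825)

Idea card `Cruxes/HyperbolicEnd/Ideas/taubes-circle-pencil.md` (round 2; triage r2-1/r2-2/r2-3: pass ×3).
Crux (fixed, never restated): every punctured homotopy 4-sphere `Σ ∖ p` carries a smooth `J`
(`J² = −1`), standard on a punctured chart ball, with NO non-constant entire `J`-curve avoiding a
smaller ball (Brody-hyperbolic modulo the end).

## The line in one paragraph

Do not certify hyperbolicity of any constructed `J` (dead line `Sketch`: certificates prove only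
`S⁴`, Thms K/S of `CertificateRuling.md`).  Take instead the RELATIVE NEAR-SYMPLECTIC FORM `ω` of
`Σ ∖ p` — it exists for every `Σ` (Gerig AGT 21 (2021) Thm 1.6: exact, asymptotically standard;
Honda 2004: Taubes' local model `ωT = dt∧dQ + ⋆dQ`, `Q = ½(a² + b² − 2c²)`, along each UNTWISTED zero
circle; Perutz 2006: two untwisted circles) — and use it as ENERGY CONTROL for Gromov's degree-one
pencil through `p∞` in `X = K_Σ ∪ (ℂP² ∖ B⁴)`, for a `J` that is `J₀` on the end, `ω`-tame off `Z`
and equal, inside the Taubes tubes, to TAUBES' SINGULAR STRUCTURE `J♭ = g_tor⁻¹ ωT / |∇Q|` (the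
`g_tor`-orthogonal complex structure of the self-dual form `ωT`; explicit below; `ω`-compatible on
the punctured tube, discontinuous at `Z`).  Every line has energy `1`; all non-compactness is
SFT-breaking at `Z`; when honest and broken members fit together ("transparency") they form a
TRANSPARENT PLANAR `J`-FOLIATION of `(Σ ∖ p) ∖ Z` — leaf map a smooth submersion to `ℂ` off `Z`,
leaves `J`-complex genus-0 curves of finite type, flat planes near `p` — and the END-GAME is a
RECOGNITION THEOREM for such foliated ends (the 4-dimensional analogue of Hofer–Wysocki–Zehnder's
characterisation of the tight `S³` by a finite-energy foliation), producing `Φ : Σ ∖ p ≃ₘ ℝ⁴` equal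
to the inverted chart near `p`; the landed glue (item 0443) + `SPC4Case` (p113806) then give the crux
with `J_hyp := Φ*i`.

## Why every stub speaks of the leaf structure OFF `Z` (twist lemma — this plan's correction of
## the card's end-game; r2-2 (c) sharpened)

TWIST LEMMA (elementary, proved on paper in `Lines/taubes-circle-pencil.md` §Twist): let `ω` be
near-symplectic, `z₀ ∈ Z`, and `V` ANY continuous oriented 2-plane field on a 3-ball `D` transverse
to `Z` at `z₀`; then every small linking sphere `∂D_r` contains a point where `ω|_V = 0`.  (Write
`ω = aA₁ + bA₂ − 2cA₃` in a self-dual frame; `ω|_V = ⟨(a,b,−2c), v⁺⟩`; `v̂⁺ : ∂D_r → S²` extends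
over `D_r`, so has degree `0`, while `(a,b,−2c)/|·|` has degree `−1`; a sign-definite pairing would
make them homotopic.  Robust under perturbations `< ½|ω|`, hence intrinsic.)  CONSEQUENCES: (1) the
leaves of a transparent pencil are `ω`-symplectic up to `Z`, so their tangent field winds with
degree `−1` about each circle and the LEAF MAP IS NEVER `C¹` ACROSS `Z` — "Thm S §4 reads off `Φ`"
(the card) and "a smooth planar submersion of `Σ ∖ p`" (this plan's first draft, rc 0 but refuted by
the lemma: with `J` tame off the OPEN tubes it forces a Lagrangian leaf on the tube boundary) are
both unavailable; (2) exempting a prover-chosen neighbourhood of `Z` from tameness collapses the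
statement into SPC4 reworded (hide everything in the exempt region).  Hence the honest typed object:
`J` and the leaf map live on `(Σ ∖ p) ∖ Z`, `J` is TAME AT EVERY POINT OFF `Z` and PINNED to `J♭`
inside the punctured tubes (rigid: the leaves near `Z` are genuine `J♭`-curves — Taubes' classified
planes — by unique continuation), and recognition from such a SINGULAR foliated end is its own stub.

## Data flow of the five registered stubs (RESHAPE r1, lead a1, 2026-08-17: the signatures are now
## one to three lines over the route-posited vocabulary of
## `Theorems/SullivanDualHyperbolicEndTaubesModelDefs.lean` — Taubes' form `taubesForm` (= `ωT`),
## Taubes' structure `taubesJ` (= `J♭`), the flat tube `taubesTube δ`, the core circle `taubesCore`,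
## and the packages `IsFlatNearSymplecticData` / `IsFlatPinnedStructure` /
## `IsFlatTransparentFoliation` (flat side) and `IsNearSymplecticData` / `IsPinnedStructure` /
## `IsTransparentFoliation` (manifold side), whose fields are the planner's clauses verbatim and in
## the same order; the planner's `let`-bound copies were truncated by the stub registry at the first
## `:=` and the apex exceeded the signature cap.  A stub worker restates a signature verbatim in a
## `Theorems/` file importing the Defs file + the route + the Literature files above.)

* `stub_modelFoliation` (SM, Σ-FREE, registered FIRST as all three triagers demand — `C⁺_model`
  with the card's kill criterion; XL): on flat `ℝ⁴` SOME Luttinger–Taubes-type data (`sf₀ = ω₀` off a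
  ball, two Taubes tubes, non-degenerate elsewhere; `J = i ⊕ i` off the ball, `= J♭` in the punctured
  tubes, `sf₀`-tame everywhere off `Z₀`) carries a TRANSPARENT PLANAR `J`-FOLIATION of `ℝ⁴ ∖ Z₀`.
* `stub_nearSymplecticData` (S1, Σ-blind existence, true in print; L paper / XL formal): every
  `Σ ∖ p` carries near-symplectic data — smooth closed `sf`, inverted-chart model on a punctured
  ball, two disjoint TAUBES TUBES `Ψ₁, Ψ₂ : U δ → Σ ∖ p` pulling `sf` back to `ωT`, `sf`
  non-degenerate off the tubes.
* `stub_noWitnessOffDefect` (S2, Σ-blind, the card's first lemma verbatim; M paper / XL formal):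
  a smooth `J` tamed off an open `N` by a smooth closed form has no entire curve avoiding `B_ε ∪ N`;
  in the line it is the NO-BUBBLING-OFF-`Z` input of the compactness step of S3 (applied to a
  smoothing of `J♭` inside a thin `N`).
* `stub_pencilFoliation` (S3, the APEX = `C⁺_transport ∧ C⁺_count`; Σ-sensitive; XL/open):
  S2 → SM → for every `(Σ, p)` carrying S1-data there are data, a `J` as above and a transparent
  planar `J`-foliation of `(Σ ∖ p) ∖ Z`.
* `stub_foliationRecognition` (S4, END-GAME; a NEW conjecture opened by the twist lemma; XL/open,
  with a 3-dimensional precedent): data + `J` + transparent planar `J`-foliation of `(Σ ∖ p) ∖ Z`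
  ⟹ `Φ : Σ ∖ p ≃ₘ ℝ⁴` agreeing with the inverted chart near `p`.
* `HyperbolicEnd_of` (PROVED, no `sorry` of its own): S1 ⊢ data; S3(S2, SM, data) ⊢ foliation;
  S4 ⊢ `Φ`; landed `sympcap_glue_chartStandardEnd` (item 0443) +
  `Sketch.hyperbolicEndAt_of_nonempty_diffeomorph_sphere` (SPC4Case p113806) ⊢ the crux AT `(S, p)`.

WHERE SPC4(Σ) SITS: in S3 ∧ S4 jointly (CostumeFull, TRIAGE-r1-2: every line of this crux is
SPC4(Σ)-complete).  Neither is SPC4 reworded: S3 ⟹ SPC4 only through S4, and S4 is an implication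
whose proof would be a recognition theorem; on `S⁴`, S3 is exactly SM (content: the planes `{w = c}`
are not `ωT`-symplectic along the torus `{a = 0}` of a tube, so the pencil MUST break at `Z`).  The
refuter's first probe (named in S4's docstring): is the hypothesis package of S4 SOFT (h-principle
for `{π₁, π₂}_sf > 0` with planar finite-type leaves)?  If yes, S3 is cheap and S4 ≡ SPC4(Σ); if no,
S3 carries the count and S4 is an honest HWZ-type theorem — either answer re-cuts the line usefully.

## RESHAPE r2 (lead a1, after wave 1, 2026-08-17)

* `stub_noWitnessOffDefect` (S2) is PROVED and LANDED — `Theorems/SullivanDualHyperbolicEndStubNoWitnessOffDefect.lean`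
  (p151187; isoperimetric ODE `A² ≤ C R A′`, no Brody lemma needed; helpers p149567 primitive of closed
  2-forms on `Σ ∖ p`, p149637 uniform domination, p149868 circulation derivative).  The stub is therefore
  no longer declared here: the theorem of the same name is imported and used by `HyperbolicEnd_of`.
* `stub_nearSymplecticData` (S1) is CLOSED MODULO the Literature named fact
  `Literature.Geometry.Symplectic.relNearSymplecticTaubesTubes_exists` (Gerig 2021 Thm 1.6 + Perutz 2006 +
  Honda 2004 + Taubes 1998 §1.c; `Literature/Geometry/Symplectic/NearSymplecticPuncturedSphere.lean`,
  p146016) through the landed staging helper `helper_nearSymplecticData_of_relNearSymplecticTaubesTubes`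
  (p147162); it stays a stub until `…_holds` is discharged (XL: Hodge theory with cylindrical ends).
* FINITE ENERGY (workers' audits of S4 and SM, reports `S4-report.md` §1d/§3, `SM-analysis.md`; lead memo
  `Lines/taubes-circle-pencil-walls.md`): the transparency packages did not type the leafwise finite
  `sf`-energy in the tubes (Taubes GT 2 (1998) Def. 1.2), without which Taubes' structure theorem at `Z`
  (Thm 1.8, Props 3.2/4.1) and everything the line card says about walls is unavailable, the typed S4 is
  strictly harder than the intended HWZ-type statement, and the typed SM/S3 are satisfiable by
  infinite-energy monsters exactly when the intended ones fail.  The clause (parametrisation-free: every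
  injectively parametrised `J`-holomorphic piece of a leaf has integrable `sf`-energy density inside the two
  tubes) is now the 4th conjunct of SM's and of S3's conclusions and an extra hypothesis of S4; S3's intended
  proof delivers it (energy-one members, Fatou), SM's must.  With it, the disprover's target (Q) of the memo
  is literally the negation of SM's local content.
* STATE AFTER WAVE 2 (same day).  SM's DATA half is closed modulo the Literature named fact
  `Literature.Geometry.Symplectic.flatNearSymplecticTaubesTubes_exists` (Perutz 2006 Prop 1.5/Rem 1.9 +
  Honda 2004 Thm 5 = Taubes 1998 §1.c; `Literature/Geometry/Symplectic/NearSymplecticFlatBirth.lean`,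
  p158668) by the landed staging helper `helper_flatNearSymplecticData_of_flatNearSymplecticTaubesTubes`
  (p159197).  SM's FOLIATION half: the wall taxonomy (i)–(iii) of the SM docstring below is SUPERSEDED —
  for the pinned `J♭` (= Taubes 1998 (1.4), not the 2006 cylindrical structure) fold walls, open-book
  walls, Taubes' model foliations F1/F2 and every `t`-equivariant local model are impossible in a
  transparent planar finite-energy foliation (lead memo `Lines/taubes-circle-pencil-walls.md` R1–R6), and
  under continuity of `π` at `Z` the only possible contact of a leaf with `Z` is a MIXED SECOND-TYPE END of
  `Φ = t + if`-degree `d ≥ 2` (`Lines/taubes-circle-pencil-SM-analysis.md` §4), whose local existence —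
  question (Q₂): a finite-energy embedded `J♭` punctured disc at a point of `Z` with Prop 4.1 data
  `(n, p, q₊, q₋) = (0, 2, 1, 1)`, necessarily with perpendicular horizontal rays and three-quarter-turn
  vertical sheets (`γ± = 3/2`, winding theorem) — is OPEN, leaning YES, blocked by one singular-perturbation
  lemma (`Lines/taubes-circle-pencil-SM-analysis-2.md` §2.5–2.7); Taubes' §5–9 do not exclude it; books of
  ends are formally unobstructed.  So SM = (named fact) ∧ (an unpublished local existence theorem + a
  coherent family along `Z` + far-field matching): crux-sized, handed to the planner (promote-stub).

* What the typed `leaves` clause already forces (S4 report §1b, new): every fibre component off `Z` is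
  conformally `ℂ ∖ (finite set)` (length–area extension of injective holomorphic punctured discs +
  exactness of `sf`); planarity needs no clause.

## STATE UNDER LEAD c5 (2026-08-17, 14:30Z; skeleton r2 unchanged, re-registered)

* No stub signature changed (r2 stands: SM, S1, S3, S4 open; S2 landed p151187).  New Σ-free registered helpers landed
  this cycle: `helper_taubesForm_momentMap` (p164735; `ι_{∂t}ωT = dQ`, `ι_{∂φ}ωT = dH`: the toric chart `(t, φ, f, h)`
  in which `ωT` is standard), `helper_taubesJ_screwPlane` (p164630; the planes `ker(ρ²(dφ − k dt)) ∩ ker(dH − kρ²dQ)`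
  are `J♭`-complex: F2 and the exact screw family of SM-analysis-2 §2.1), `helper_taubesForm_taubesJ_taubesJ`
  (p164695; `J♭` is `ωT`-symplectic).
* Both Σ-blind named facts are in active discharge by literature seats (S1: `relNearSymplecticTaubesTubes_exists`
  reduced to Gerig (G) + Honda (H′), `Literature/Geometry/Symplectic/NearSymplecticTwoCirclesReductionStrict.lean`;
  SM data half: `flatNearSymplecticTaubesTubes_exists`, `…/NearSymplecticFlatBirthProofs.lean` part I).  When
  `…_holds` lands, S1 closes by the staging helper p147162 and this file imports it (sorries 4 → 3).
* Mathematics of SM's foliation half (`Lines/taubes-circle-pencil-c5-memo.md`): (§1) the zero circles carry FREE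
  λ-PERIODS `kᵢ = ∮_{Zᵢ}λ` (`> 0` in every `S¹`-symmetric birth model), so the inherited "t-circle flux = −2πQ" steps of
  the walls memo ((R4a), (R6a) case 1) are the `k = 0` case — no load-bearing result used them; (§2) THEOREM: under
  hypothesis (i) NO transparent planar finite-energy `J♭`-foliation near a point of `Z` is invariant under the local
  `t`-translations, for ANY contact type (one-line transversality lemma: a non-vertical `J♭`-curve projects to a surface
  transverse to `∇f`; then IVT + single-sheet covering) — closing the gap left for second-type contact leaves; corollary:
  the contact leaves along `Z` are not translates of one another.  (Q₂) itself (existence of one mixed end) and the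
  compatibility of a `t`-dependent family of such ends with transparency remain OPEN; verdict on SM unchanged.

## STATE UNDER LEAD c6 (2026-08-17, from 14:31Z; skeleton r2 unchanged, re-registered; memo `Lines/taubes-circle-pencil-c6-memo.md`,
## referee report `…-c6-referee.md`, worker analysis `…-c6-no-i.md`)

* No stub signature changed.  Landed this cycle (Σ-free, registered, `--supports`): `helper_taubesJ_graphSystem` (p168205; the
  graph Cauchy–Riemann system `h_f = ρ²φ_t`, `h_t = −|∇Q|²ρ²φ_f` of a `J♭`-curve transverse to F1, from `helper_taubesJ_coframe`) and
  the S1 staging `helper_nearSymplecticData_of_twoEvenCircles_of_hondaNormalForm` (p168291; S1 ⇐ (G') Gerig 2021 Thm 1.6 ∧ (H')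
  Honda 2004 Thm 5 through the strict Literature reduction — the exact residual of S1; `…_holds` of neither Literature fact has
  landed yet).
* MATHEMATICS OF SM's FOLIATION HALF (memo §2–§5C; [P] = proved on paper, refereed where stated).  THEOREM A/A′ (charge conservation;
  adversarially refereed, VERIFIED): near an end of a `Z`-ended leaf all honest local sheets are discs meeting the `J♭`-holomorphic
  half-plane `Σ^φ = {φ = const, z = 0}` in one and the same number of points; across a wall pierced by `Z` the Euler characteristic of
  the local sheet would have to drop by `2 = −c₁(S)` (the charge of `J♭` on the linking sphere) — the round handle of
  Auroux–Donaldson–Katzarkov's singular Lefschetz pencils, FORCED for `J`-holomorphic leaves.  THEOREM B: under hypothesis (i)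
  ("`π` continuous at `Z`") the contact map `π̄|_Z` is injective on no arc.  THEOREM N (stub-worker analysis): (i) holds on NO arc —
  book points (uncountably many leaves ending at one point) are dense in `Z`.  THEOREM D: distinct leaves have total linking `0` over
  their common ends, so book pages are pairwise unlinked: round-cone books and the second-type book design of SM-analysis-2 §3 are
  dead, a book needs osculating pages.  THEOREM E: in a pure book region every book separates the plane; THEOREM F: there the charge
  `Hor·S = −2` forces branch points of pages to escape into `Z` near every point (no uniform conical structure); THEOREM E′: with
  uniform structure a ring book is impossible (`H₁` count).  Rotation self-linking `sl_φ = 1 + ⌊γ₊/2⌋ + ⌊γ₋/2⌋` and end-type index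
  `λ^φ ∈ {1, 3}` computed; all conventions coherent.
* CONSEQUENCE: the wall picture presupposed by the card (`Transfer` (ii)–(iii)), by the SM/S3 docstrings below ("wall leaves = top
  levels of lines broken at `Z₀`", "two-sided gluing", walls (A)/(A′)/(C)) and by S4's "chambers ∪ walls `π⁻¹(γ)`" is REFUTED for
  every contact type; the typed SM survives only through book configurations that are wild at every scale at a dense set of points
  of `Z` (Thms N, D, E, F), for which no design, precedent or role in S3/S4's plans exists.  Lead's verdict (cycle 1): SM (r2, finite
  energy) is false for every purpose of this line; the line is expected to be declared dead at `stub_modelFoliation` in cycle 2 after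
  the last worker analysis (books) is integrated; constructive residue for the planners: a `J`-holomorphic BROKEN pencil with round
  handles + recognition from a genus-1 broken Lefschetz pencil (memo §6).

## Disproof.lean honoured

`payload.disproof_path` does not exist and no `Cruxes/HyperbolicEnd/Disproof.lean` was ever
published (confirmed again 2026-08-17, as by all five triagers of rounds 1–2): no `_false_without_`
theorem to cite.  Landed negatives checked: `Theorems/HyperbolicEnd/Negative/*` (FrozenFillE4
p130626 …) refute CERTIFICATE fillings — no stub here posits a certificate, plug or filling;
`Negative/AdmissibleJ.lean` (p125825: any closing file constructs an admissible `J`) is met because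
the crux's `J` is `Φ*i` built by the landed SPC4Case from `Φ`; paper Theorems K/R/S
(`CertificateRuling.md`): Thm R §2.2 (exterior graphs) is REUSED as the asymptotics/far-flat clauses,
Thm S §4 is REPLACED by S4 (the twist lemma shows why it cannot be reused).
`Literature.Geometry.Symplectic.not_jPlanePencil_localFamily` (p132675, `Bl₀ ℂ²`): excluded by
`H₂(K_Σ) = 0` (energy quantisation), cf. card "Disproof used".  `ledger negatives`: 0 statements.
-/

noncomputable section

-- the prescribed crux namespace repeats the component `SmoothPoincare4`
set_option linter.dupNamespace false

open scoped Manifold ContDiff Topology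
open Set Literature.Geometry.Kaehler Literature.Geometry.Symplectic Literature.Topology.FourManifolds

namespace Summit.SmoothPoincare4.SmoothPoincare4.Cruxes.HyperbolicEnd.TaubesCirclePencil


/-- **Stub SM — `C⁺_model`: the Luttinger–Taubes ball carries a transparent planar `J`-foliation
(Σ-FREE; registered FIRST, with the card's kill criterion; XL).**
CONVENTIONS shared by all signatures of this file (the named terms of
`SullivanDualHyperbolicEndTaubesModelDefs.lean`; in the planner's skeleton they were `let`-bound): flat
`ℝ⁴ = ℂ²`, `z = y₀ + i y₁`, `w = y₂ + i y₃`, `ω₀ = stdSymplecticForm`, `i ⊕ i = (a ↦ (−a₁, a₀, −a₃, a₂))`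
(the structure with `⟪(i⊕i) a, b⟫ = ω₀(a, b)`, i.e. the crux's "standard `J`" read in inverted
coordinates); `U δ = {(√(y₀²+y₁²) − 1)² + y₂² + y₃² < δ²}` the flat solid torus about the core circle
`C = {y₀² + y₁² = 1, y₂ = y₃ = 0}`; toroidal coordinates `t = arg(y₀ + i y₁)`, `a = √(y₀²+y₁²) − 1`,
`b = y₂`, `c = y₃`, coframe `(dt, da, db, dc)` with dual frame `e₀ = (−y₁, y₀, 0, 0)`,
`e₁ = (y₀, y₁, 0, 0)/r`, `e₂`, `e₃`, declared orthonormal (metric `g_tor`); `ωT y u v` = TAUBES' FORM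
`ωT = dt ∧ dQ + ⋆ dQ = a A₁ + b A₂ − 2c A₃`, `Q = ½(a² + b² − 2c²)`, `A₁ = dt∧da + db∧dc`,
`A₂ = dt∧db + dc∧da`, `A₃ = dt∧dc + da∧db` (closed — `Q` is harmonic —, self-dual for `g_tor`,
`ωT ∧ ωT = 2(a² + b² + 4c²) vol`, zero set `C`, `∇ωT` of rank 3: the UNTWISTED local model of a
near-symplectic zero circle, Taubes GT 2 (1998), Honda 2004); `Jb y u` = TAUBES' SINGULAR ALMOST
COMPLEX STRUCTURE `J♭ = (a J₁ + b J₂ − 2c J₃)/√(a² + b² + 4c²)`, `g_tor(J_k u, v) = A_k(u, v)`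
(`J₁J₂ = J₃`, quaternionic), i.e. the `g_tor`-orthogonal complex structure whose fundamental form is
`ωT/|ωT|·√2`: `J♭² = −1`, `ωT(u, J♭ u) = √(a²+b²+4c²)·|u|²_tor > 0` on `U δ ∖ C` (TAME and
compatible), `J♭ ∂_t = ∇Q/|∇Q|`, horizontal planes `ker dt ∩ ker dQ` are `J♭`-complex (so the
surfaces `{t₀} × {Q = const}` are `J♭`-holomorphic), discontinuous at `C` — written out in the flat
coordinates `y, u`.  A TAUBES TUBE of a form `sf` is a smooth injective immersion `Ψ` of `U δ`
pulling `sf` back to `ωT`; "`J = Ψ_* J♭` in the punctured tube" is the clause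
`J (Ψ y) (dΨ u) = dΨ (Jb y u)` for `y ∈ U δ ∖ C`.
STATEMENT (typed shadow of `C⁺_model`, on flat `ℝ⁴`): there are `R`, `0 < δ < 1`, a smooth closed
2-form `sf₀` equal to `ω₀` on `{R ≤ ‖y‖}`, two Taubes tubes `Ψ₁, Ψ₂` of `sf₀` inside the ball with
disjoint images, `sf₀` non-degenerate off the tubes (so `sf₀` is near-symplectic with zero set the two
untwisted circles `Z₀ = Ψ₁ '' C ∪ Ψ₂ '' C`); a `J` defined off `Z₀` — `J² = −1`, smooth, `= i ⊕ i` on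
`{R ≤ ‖y‖}`, `sf₀`-TAME AT EVERY POINT OFF `Z₀`, and `= Ψᵢ_* J♭` in the punctured tubes; and a
TRANSPARENT PLANAR `J`-FOLIATION of `ℝ⁴ ∖ Z₀`: a map `π : ℝ⁴ → ℂ`, smooth and submersive off `Z₀`,
`ker dπ` `J`-invariant off `Z₀` (the leaves are `J`-complex), `C¹`-asymptotic to `w` at infinity and
EQUAL to `w` on `{R' ≤ |w|}` (far leaves are the flat lines), every leaf `π⁻¹(t) ∖ Z₀` being a finite
union of images of injective `J`-holomorphic maps `ℂ ∖ (finite set) → ℝ⁴ ∖ Z₀` (genus 0, finite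
type: honest lines are whole planes, WALL LEAVES = top levels of lines broken at `Z₀` are punctured
planes/spheres).  Nothing is asked AT `Z₀` (twist lemma, module docstring).
PAPER STATEMENT IT SHADOWS (card `Transfer`/`Cheapest falsifier`, sharpened by TRIAGE-r2-1 §(2),
r2-3): glue the Luttinger–Simpson birth pair (Gerig AGT 2021 Ex. 1.7, made asymptotically standard)
into `B⁴ ⊂ ℂP²`; `J₀` outside, `J♭` in the tubes (Taubes' metric structure; in Taubes'/Gerig's
symplectisation coordinates on `N(Z) ∖ Z` it is the cylindrical `J` over `(S¹×S², λ_T)` — or use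
Gerig's `L`-flat `λ_A`, GT 24 (2020) Lemma 3.6/3.7: r2-1 (2c), automatic transversality and Taubes'
2006 classification cannot both be had — the `∃ J` between tubes and end leaves that choice open),
generic tame in between; then (i) list the `J`-planes of `ℝ×(S¹×S²)` positively asymptotic to a
contractible torus orbit `T(arccos ±1/√3)` and to `e₀/e_π` with energy below the `N(Z)` scale (Taubes
GT 10 (2006)); (ii) ENERGY INTEGRALITY (r2-3; free, homological: a class-zero top level has
`E_ω ∈ ℤ`, so near a point of `Z` the pencil breaks only as type (A) — connected top level, ONE
contractible end capped by a horizontal sheet `{t₀}×{Q = c < 0, ±c' > 0}`, a `J♭`-holomorphic disc —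
(A′) corners, or (C) — `p∞`-component negatively asymptotic to a polar orbit `e₀/e_π` joined below by
the invariant cylinder `S¹×{r²z = k}`): decide whether each type-(A) wall is TWO-SIDED (a second cap
with opposite gluing sign in Taubes' tables; obstruction-bundle count `±1`, Hutchings–Taubes JSG
2007/2009) or absent (r2-1 (2a): one-sided for embedded genus-0 pencils barring a second breaking);
(iii) show the type-(C) leaves at `e₀` (resp. `e_π`) form a 1-parameter family of pairwise disjoint
planes (Siefring GT 15 (2011); Gerig GT 2020 Ex. 3.11: the `c_τ = 1` planes at `e₀` are
`ind = I = 0`).  Then honest + broken members form a closed 2-manifold `M̄ ≅ S²` of pairwise disjoint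
leaves covering `X ∖ Z₀`, the leaf map is a smooth submersion OFF `Z₀` (smoothness across wall leaves
away from `Z₀`: gluing is a local diffeomorphism onto a neighbourhood — part of the statement), and
the typed witness follows (the `∃ J` already allows the card's retreat "a better smoothing of `J`
between tube and end").  KILL (verbatim from the card): if already in `ℂP²` some winding-zero wall
has glued count `0`, or `Z`-ended members sweep an open set with multiplicity, transparency fails in
the model and the line dies.  Why NOT trivially true: `π = w`, `J = i ⊕ i` would need the planes
`{w = c}` to be `sf₀`-symplectic up to `Z₀`, but along the torus `{a = 0}` of a tube about a circle in
a fibre they are `ωT`-Lagrangian (`ωT|_{span(e₀,e₁)} = −a dt∧da`), and for any placement the twist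
lemma forces the leaf field to wind about `Z₀` — the pencil MUST break at `Z₀`, and inside the tubes
the leaves are genuine `J♭`-curves (rigid), so the content is exactly the wall structure (i)–(iii).
Why plausibly true: Taubes' complete description of the invariant moduli in `ℝ×(S¹×S²)` (GT 10
(2006)) makes (i)–(iii) a finite check; degree one and `c₁(L) = 3` give automatic transversality of
every immersed piece (Wendl CMH 85 (2010) Thm 1).  Size: XL (paper); in Lean only by explicit
formulas.  Leans on: `stdSymplecticForm`, Mathlib `extDeriv`, `ContDiff(On/At)`, `fderiv`.
[cite: Taubes doi:10.2140/gt.1998.2.221; doi:10.2140/gt.2006.10.785; doi:10.2140/gt.2006.10.1855;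
Gerig doi:10.2140/gt.2020.24.1791 §3; doi:10.2140/agt.2021.21.2543 Ex. 1.7; Siefring
doi:10.2140/gt.2011.15.2351; Hutchings–Taubes doi:10.4310/jsg.2009.v7.n1.a2; Wendl doi:10.4171/cmh/199] -/
theorem stub_modelFoliation :
    ∃ (R δ : ℝ) (sf₀ : EuclideanSpace ℝ (Fin 4) → EuclideanSpace ℝ (Fin 4) [⋀^Fin 2]→L[ℝ] ℝ) (Ψ₁ Ψ₂ : EuclideanSpace ℝ (Fin 4) → EuclideanSpace ℝ (Fin 4)) (J : EuclideanSpace ℝ (Fin 4) → EuclideanSpace ℝ (Fin 4) →L[ℝ] EuclideanSpace ℝ (Fin 4)) (π : EuclideanSpace ℝ (Fin 4) → ℂ),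
      IsFlatNearSymplecticData R δ sf₀ Ψ₁ Ψ₂ ∧ IsFlatPinnedStructure R δ sf₀ Ψ₁ Ψ₂ J ∧
        IsFlatTransparentFoliation Ψ₁ Ψ₂ J π ∧
        (∀ (u : ℂ → EuclideanSpace ℝ (Fin 4)) (U : Set ℂ) (t : ℂ), IsOpen U → Set.InjOn u U →
          ContDiffOn ℝ ∞ u U →
          (∀ z ∈ U, ∀ ζ : ℂ, fderiv ℝ u z (Complex.I * ζ) = J (u z) (fderiv ℝ u z ζ)) →
          u '' U ⊆ π ⁻¹' {t} ∩ (Ψ₁ '' taubesCore ∪ Ψ₂ '' taubesCore)ᶜ →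
          MeasureTheory.IntegrableOn
            (fun z : ℂ => sf₀ (u z) ![fderiv ℝ u z 1, fderiv ℝ u z Complex.I])
            (U ∩ u ⁻¹' (Ψ₁ '' taubesTube δ ∪ Ψ₂ '' taubesTube δ))) := by
  sorry

/-- **Stub S1 — relative near-symplectic data with two Taubes tubes exist on every punctured homotopy
4-sphere (Σ-BLIND EXISTENCE; true in print; L on paper / XL formally).**  For every `Σ` and `p` there
are `ε > 0` with `closedBall (e p) ε` inside the chart target, a tube radius `0 < δ < 1`, a smooth
closed 2-form `sf` on `Σ ∖ p` equal to the inverted-chart model `ι*ω₀` on the punctured `ε`-ball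
(verbatim the clause of `RelativeSullivanDuality` / `ClosedModelExtension`), and two TAUBES TUBES
`Ψ₁, Ψ₂ : ℝ⁴ → Σ ∖ p` — smooth injective immersions on the flat solid torus `U δ`, images disjoint
from each other and from the punctured `ε`-ball, with `Ψᵢ* sf = ωT` (conventions in
`stub_modelFoliation`) — such that `sf` is non-degenerate at every point off `Ψ₁ '' U δ ∪ Ψ₂ '' U δ`.
Consequently `sf` vanishes exactly on the two UNTWISTED circles `Zᵢ = Ψᵢ '' C`, transversally (rank
`∇sf = 3` is built into `ωT`), and is symplectic elsewhere: the card's `RelNearSymplecticExists` with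
the transversality the ideator left untyped now carried by the model tubes (no `IsNearSymplectic`
definition is needed).  Proof in print: Gerig, AGT 21 (2021) Thm 1.6 + Appendix ("there exist (exact)
near-symplectic forms on `X*` which are asymptotically standard", `X*` = punctured homotopy sphere
with the flat end: `L²`-Hodge theory on the cylindrical completion + Honda's transversality rel the
end + cut-off to the model; read at page level by r2-1/r2-2/r2-3); Honda, Crelle 577 (2004) (local
model of a near-symplectic form along an untwisted zero circle: `S¹×B³` with `dt∧dQ + ⋆dQ`; compose
his chart with the toroidal coordinates `T : U δ → S¹×B³(δ)`, `T(y) = (arg(y₀+iy₁), √(y₀²+y₁²) − 1,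
y₂, y₃)` — this is exactly how `ωT` is defined, so no orientation convention enters); Perutz, JSG 4
(2006) (zero-set modification: an even number of untwisted circles — parity `1 − b₁ + b⁺ = 2` for
`Σ # ℂP²`, Gerig 2021 p. 8 — realised as exactly two; `2k` circles would serve the line verbatim).
Why it might fail (as a TYPED statement only): the packaging — `Ψᵢ` total functions on `ℝ⁴`
restricted to `U δ`, `mfderiv`-pullback clause, `Disjoint` images — must match the printed normal
form up to `T`; it does by construction.  Size: L (paper, three cited theorems) / XL (Lean: Hodge
theory, Moser-type normal form).  Leans on: `MForm`, `IsSmoothForm`, `IsClosedForm`,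
`InPuncturedChartBall`, `invertedStdForm`, `HomotopySphere`.  Used by: the data hypothesis of
`stub_pencilFoliation` (fed at `(S, p)` in `HyperbolicEnd_of`).
[cite: Gerig doi:10.2140/agt.2021.21.2543 Thm 1.6; Honda doi:10.1515/crll.2004.2004.577.105;
Perutz doi:10.4310/jsg.2006.v4.n3.a1; Taubes doi:10.2140/gt.1998.2.221] -/
theorem stub_nearSymplecticData :
    ∀ (S : HomotopySphere 4) (p : S.carrier),
      ∃ (ε δ : ℝ) (sf : MForm (𝓡 4) ↥(punctured p) ℝ 2) (Ψ₁ Ψ₂ : EuclideanSpace ℝ (Fin 4) → ↥(punctured p)),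
        IsNearSymplecticData p ε δ sf Ψ₁ Ψ₂ := by
  sorry

/-! **S2 — `stub_noWitnessOffDefect` is LANDED** (`Theorems/SullivanDualHyperbolicEndStubNoWitnessOffDefect.lean`,
p151187): imported above; its statement is repeated verbatim as the first hypothesis of S3. -/

/-- **Stub S3 — the PENCIL FOLIATION (apex; `C⁺_transport ∧ C⁺_count` of the card; Σ-SENSITIVE;
XL/open).**  Hypotheses BY STATEMENT: the statement of `stub_noWitnessOffDefect` (S2) and the
statement of `stub_modelFoliation` (SM), each verbatim.  Conclusion: for every homotopy 4-sphere `Σ`, point `p`, and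
near-symplectic data as produced by `stub_nearSymplecticData` (S1), there exist such data
`(ε, δ, sf, Ψ₁, Ψ₂)` (re-exported: the prover may re-choose the form), a `J` on `(Σ ∖ p) ∖ Z`,
`Z = Ψ₁ '' C ∪ Ψ₂ '' C` — `J² = −1` and smooth in tangent coordinates off `Z`, standard
(`= (ι∘(e − e p))*i`, the crux's clause verbatim) on the punctured `ε`-ball, `sf`-TAME AT EVERY POINT
OFF `Z`, and `= Ψᵢ_* J♭` (Taubes' singular structure) in the punctured tubes — and a TRANSPARENT
PLANAR `J`-FOLIATION of `(Σ ∖ p) ∖ Z`: `π : Σ ∖ p → ℂ`, smooth and submersive at every point off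
`Z`, `ker dπₓ` `J`-invariant off `Z` (leaves are `J`-complex), `C¹`-ASYMPTOTIC TO THE PENCIL
COORDINATE at `p` (for every `η > 0` some punctured chart ball `B_ρ` has `‖π − w‖ ≤ η` and
`‖d(π − w) v‖ ≤ η ‖dy v‖`, `w = (pencilCoord p ·).2`, `y = ι(e · − e p)`), EQUAL to `w` where
`|w| ≥ R` on the punctured ball (far leaves are the flat lines), and with every leaf `π⁻¹(t) ∖ Z` a
finite union of images of injective `J`-holomorphic maps `ℂ ∖ (finite set) → (Σ ∖ p) ∖ Z` (genus 0,
finite type).  PAPER PROOF PLAN (card `Transfer`, sharpened by the panel and by the twist lemma).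
Take the S1-data; `J := J₀` on the end, `Ψᵢ_* J♭` in the tubes (tame there automatically:
`Ψᵢ* sf = ωT` and `J♭` is `ωT`-compatible), generic `sf`-tame in between (contractible choice,
smooth matching across the tube boundary); compactify `X = (Σ ∖ p) ∪ ℓ∞`,
`H₂(X ∖ Z) = ℤL′ ⊕ ℤS₁ ⊕ ℤS₂`, `ω(L′) = 1`, `ω(Sᵢ) = 0`.  TRANSPORT (homological + local,
Σ-blind): (1) exterior halves of members are bounded holomorphic graphs, Montel (Thm R §2.2,
reused — these are the asymptotics and far-flat clauses); (2) energy `≡ 1` + quantisation + S2 ⇒ no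
degeneration away from `Z`; BEHWZ/Taubes compactness at `Z` in Taubes' symplectisation coordinates
for `(N(Z) ∖ Z, ωT, J♭)` after Gerig's Morse–Bott perturbation (GT 2020 §3.2); (3) ENERGY
INTEGRALITY (r2-3): class-zero top levels have integer energy, so only wall types (A)/(A′)/(C) of SM
occur in ANY `K_Σ`, and near `Z` the leaves are the SAME `J♭`-curves as in the model (imported
through `Ψᵢ`); (4) every immersed piece is regular for every `J` (Wendl 2010; `c₁(L) = 3`, genus 0;
adjunction keeps limits embedded — tree fact `jHolomorphicLimitOfEmbedded_isEmbedded`), the local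
family at honest members is the route's `PencilLocalFamily` (Wendl Prop. 2.53, `m = 1`), so the leaf
map is a smooth submersion off the walls and — by two-sided gluing — off `Z` altogether.  COUNT (the
Σ-sensitive residue, where `π₁(K_Σ) = 1` must be spent — the card's `K′` calibration shows every
Σ-blind version is false on the spun Poincaré ball): the winding-zero top-level moduli through `p∞`
carry no cancelling pairs and `ev` is injective on them, i.e. no compact region of `K_Σ` is entered
by no honest line and swept with cancelling signs by `Z`-ended top levels (a chain-level statement
invisible to ECH — Gerig GT 2020 Prop. 3.2, `ECH_*(S¹×S², ξ₀, Γ ≠ 1) = 0` — and to SW, as it must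
be); granted this, `4 = χ(Bl X) = 2χ(M̄)` forces `M̄ ≅ S²`, footprints are disjoint off `Z`, and the
foliation is global.  COSTUME AUDIT: S3 ⟹ SPC4(Σ) only through S4 (a recognition theorem yet to be
proved — so S3 may even be strictly WEAKER than SPC4(Σ)); SPC4(Σ) ⟹ S3 only through SM (content);
tameness is required at every point off the measure-zero `Z` and `J` is pinned inside the tubes, so
nothing can be hidden near `Z` (the collapse that kills any "tame off a neighbourhood" phrasing).
Why it might fail: an exotic `Σ` may still carry such a foliation only if S4 fails — otherwise an
exotic `Σ` refutes S3 (prize); short of that, the COUNT may fail for every admissible `J` on some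
`K_Σ` (a wall type with vanishing glued count: a chain-level exoticness certificate, itself
informative); and SM may fail in the model (kill criterion).  Calibration to run first (refuter):
Gluck twists (`X ≅ ℂP²`, so the sweep reads only the isotopy class of `ℓ∞`; consistent — `J₀` is
frozen on the exterior; r2-2 (d)).  Size: XL/open.  Leans on: S1, S2, SM by name; route items
`PencilLocalFamily` (16772), `LimitOfEmbeddedPlanes` (16809), the `SullivanDualWitnessCharge*.lean`
exterior-structure files (Zalcman p109847, Arzelà–Ascoli p109831); `pencilCoord`,
`InPuncturedChartBall`, `inversion`, `stdSymplecticForm`. [cite: Gromov1985 §2.4.A′; Wendl2018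
Prop. 2.53, Thm 2.46; Wendl doi:10.4171/cmh/199; BEHWZ arXiv:math/0308183; Siefring
doi:10.2140/gt.2011.15.2351; Hutchings–Taubes doi:10.4310/jsg.2007.v5.n1.a5,
doi:10.4310/jsg.2009.v7.n1.a2; Gerig doi:10.2140/gt.2020.24.1791, doi:10.2140/agt.2021.21.2543;
Taubes doi:10.2140/gt.1999.3.167] -/
theorem stub_pencilFoliation :
    (∀ (S : HomotopySphere 4) (p : S.carrier)
      (J : ∀ x : ↥(punctured p), TangentSpace (𝓡 4) x →L[ℝ] TangentSpace (𝓡 4) x)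
      (sf : MForm (𝓡 4) ↥(punctured p) ℝ 2) (N : Set ↥(punctured p)) (ε : ℝ), 0 < ε → IsOpen N →
      (∀ (x : ↥(punctured p)) (v : TangentSpace (𝓡 4) x), J x (J x v) = -v) →
      (∀ x₀ : ↥(punctured p), ContMDiffAt (𝓡 4) 𝓘(ℝ, EuclideanSpace ℝ (Fin 4) →L[ℝ] EuclideanSpace ℝ (Fin 4)) ∞
        (inTangentCoordinates (𝓡 4) (𝓡 4) (id : ↥(punctured p) → ↥(punctured p)) id (fun x => J x) x₀) x₀) →
      IsSmoothForm sf → IsClosedForm sf →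
      (∀ x : ↥(punctured p), x ∉ N → ∀ v : TangentSpace (𝓡 4) x, v ≠ 0 → 0 < sf x ![v, J x v]) →
      ¬ ∃ u : ℂ → ↥(punctured p),
        (ContMDiff 𝓘(ℝ, ℂ) (𝓡 4) ∞ u ∧ (∃ z z' : ℂ, u z ≠ u z') ∧
          (∀ z ζ : ℂ, mfderiv 𝓘(ℝ, ℂ) (𝓡 4) u z (Complex.I * ζ : ℂ) =
            J (u z) (mfderiv 𝓘(ℝ, ℂ) (𝓡 4) u z (ζ : ℂ))) ∧
          (∀ z : ℂ, ¬ InPuncturedChartBall p ε (u z)) ∧ (∀ z : ℂ, u z ∉ N))) →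
    (∃ (R δ : ℝ) (sf₀ : EuclideanSpace ℝ (Fin 4) → EuclideanSpace ℝ (Fin 4) [⋀^Fin 2]→L[ℝ] ℝ) (Ψ₁ Ψ₂ : EuclideanSpace ℝ (Fin 4) → EuclideanSpace ℝ (Fin 4)) (J : EuclideanSpace ℝ (Fin 4) → EuclideanSpace ℝ (Fin 4) →L[ℝ] EuclideanSpace ℝ (Fin 4)) (π : EuclideanSpace ℝ (Fin 4) → ℂ),
      IsFlatNearSymplecticData R δ sf₀ Ψ₁ Ψ₂ ∧ IsFlatPinnedStructure R δ sf₀ Ψ₁ Ψ₂ J ∧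
        IsFlatTransparentFoliation Ψ₁ Ψ₂ J π ∧
        (∀ (u : ℂ → EuclideanSpace ℝ (Fin 4)) (U : Set ℂ) (t : ℂ), IsOpen U → Set.InjOn u U →
          ContDiffOn ℝ ∞ u U →
          (∀ z ∈ U, ∀ ζ : ℂ, fderiv ℝ u z (Complex.I * ζ) = J (u z) (fderiv ℝ u z ζ)) →
          u '' U ⊆ π ⁻¹' {t} ∩ (Ψ₁ '' taubesCore ∪ Ψ₂ '' taubesCore)ᶜ →
          MeasureTheory.IntegrableOn
            (fun z : ℂ => sf₀ (u z) ![fderiv ℝ u z 1, fderiv ℝ u z Complex.I])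
            (U ∩ u ⁻¹' (Ψ₁ '' taubesTube δ ∪ Ψ₂ '' taubesTube δ)))) →
    ∀ (S : HomotopySphere 4) (p : S.carrier),
      (∃ (ε δ : ℝ) (sf : MForm (𝓡 4) ↥(punctured p) ℝ 2) (Ψ₁ Ψ₂ : EuclideanSpace ℝ (Fin 4) → ↥(punctured p)),
        IsNearSymplecticData p ε δ sf Ψ₁ Ψ₂) →
      ∃ (ε δ : ℝ) (sf : MForm (𝓡 4) ↥(punctured p) ℝ 2) (Ψ₁ Ψ₂ : EuclideanSpace ℝ (Fin 4) → ↥(punctured p))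
        (J : ∀ x : ↥(punctured p), TangentSpace (𝓡 4) x →L[ℝ] TangentSpace (𝓡 4) x) (π : ↥(punctured p) → ℂ),
        IsNearSymplecticData p ε δ sf Ψ₁ Ψ₂ ∧ IsPinnedStructure p ε δ sf Ψ₁ Ψ₂ J ∧
          IsTransparentFoliation p ε Ψ₁ Ψ₂ J π ∧
        (∀ (u : ℂ → ↥(punctured p)) (U : Set ℂ) (t : ℂ), IsOpen U → Set.InjOn u U →
          ContMDiffOn 𝓘(ℝ, ℂ) (𝓡 4) ∞ u U →
          (∀ z ∈ U, ∀ ζ : ℂ, mfderiv 𝓘(ℝ, ℂ) (𝓡 4) u z (Complex.I * ζ : ℂ) =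
            J (u z) (mfderiv 𝓘(ℝ, ℂ) (𝓡 4) u z (ζ : ℂ))) →
          u '' U ⊆ π ⁻¹' {t} ∩ (Ψ₁ '' taubesCore ∪ Ψ₂ '' taubesCore)ᶜ →
          MeasureTheory.IntegrableOn
            (fun z : ℂ => sf (u z) ![mfderiv 𝓘(ℝ, ℂ) (𝓡 4) u z (1 : ℂ), mfderiv 𝓘(ℝ, ℂ) (𝓡 4) u z Complex.I])
            (U ∩ u ⁻¹' (Ψ₁ '' taubesTube δ ∪ Ψ₂ '' taubesTube δ))) := by
  sorry

/-- **Stub S4 — END-GAME: recognition of a transparently foliated near-symplectic end (a NEW front,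
opened by the twist lemma; the 4-dimensional analogue of Hofer–Wysocki–Zehnder's characterisation of
the tight 3-sphere by a finite-energy foliation; XL/open).**  For every `Σ`, `p`, near-symplectic
data `(ε, δ, sf, Ψ₁, Ψ₂)` (S1's clauses), every `J` on `(Σ ∖ p) ∖ Z` as in S3 (tame off `Z`,
standard near `p`, `= Ψᵢ_* J♭` in the punctured tubes) and every transparent planar `J`-foliation
`π` of `(Σ ∖ p) ∖ Z` (S3's clauses verbatim), there is a diffeomorphism `Φ : Σ ∖ p ≃ₘ ℝ⁴` with
`AgreesWithInvertedChartNear p Φ` — the hypothesis of the landed glue `sympcap_glue_chartStandardEnd`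
(item 0443).  WHY A SEPARATE STUB (twist lemma, module docstring): the leaf map of such a foliation
is never `C¹` across `Z` (its leaves are `sf`-symplectic up to `Z`, so their tangent field has degree
`−1` about each circle), hence the smooth end-games — Thm S §4's uniformiser coordinates, or
"straighten + complete Ehresmann connection + Smale `Diff(D² rel ∂) ≃ *`" (which DOES prove: a smooth
submersion `Σ ∖ p → ℂ`, `C¹`-asymptotic to `w`, gives `Φ`; one page, recorded in the line card as the
lemma this stub must generalise) — do not apply; no surgery supported near `Z` can smooth the leaf
field (the degree is a topological invariant).  WHAT A PROOF MUST DO: use the local structure at `Z`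
— inside the tubes the leaves are `J♭`-curves, i.e. (after Taubes' change of coordinates) pieces of
the CLASSIFIED finite-energy punctured spheres of `ℝ×(S¹×S²)` (Taubes GT 10 (2006)): horizontal
sheets `{t₀}×{Q = c}` (discs for `c < 0`, annuli for `c > 0`, the cone for `c = 0` — the indefinite
FOLD model `(t, Q)`), polar half-cylinder families at `e₀/e_π` (open-book type) — to decompose
`Σ ∖ p = chambers ∪ walls`: off the wall locus `Γ = π(walls) ⊂ ℂ` the leaf map is a trivial plane
bundle over each component of `ℂ ∖ Γ` (local families are uniform along the flat ends of the leaves),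
so each chamber is `ℝ² × (planar domain)`, and the topology of `Σ ∖ p` is carried by how chambers
meet along the 3-dimensional wall hypersurfaces `π⁻¹(γ) ∪ (Z-part)`; show this attachment is
standard for each admissible wall type (for fold-type walls this is a ROUND-HANDLE statement: one
round 1-handle per zero circle on a homotopy 4-ball with `S³` boundary — for a single circle this is
Gabai's Property R, for two it touches generalised Property R (Gompf–Scharlemann–Thompson 2010): the
place where `π₁(K_Σ) = 1` is spent if it is not spent in S3's count), then finish with the smooth
lemma above on a modified submersion away from `Z`.  WHY IT MIGHT FAIL: (a) the hypothesis package
may be SOFT — if pairs `(π₁, π₂)` with `{π₁, π₂}_{sf} > 0` (symplectic leaves) and planar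
finite-type leaves obey an h-principle on `(Σ ∖ p) ∖ Z` relative to the pinned germs at `Z` and at
`p`, every `Σ` carries such a foliation and S4 ≡ SPC4(Σ) (then the line must re-cut: rigidity would
have to come from an energy/compactness clause on the family, e.g. `M̄` compact); the refuter's
first probe; (b) an admissible wall type whose chamber attachment is a genuinely knotted round handle
would make S4 as hard as generalised Property R.  WHY PLAUSIBLY TRUE: in dimension 3 exactly this
works (HWZ, Ann. Math. 148 (1998) / Duke 81 (1995): a finite-energy foliation recognises `S³`;
Wendl's planar open books); here the leaves are rigid `J♭`-curves near `Z`, flat planes near `p`, and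
the leaf space is forced to be `S²`.  Size: XL/open (paper); the smooth sub-lemma M (paper) / L–XL
(Lean: flows, `Diffeomorph`, Smale as a named fact).  Leans on: `pencilCoord`, `inversion`,
`InPuncturedChartBall`, `AgreesWithInvertedChartNear`, `agreesWithInvertedChartNear_of`, Mathlib
`Diffeomorph`, `Mathlib.Geometry.Manifold.IntegralCurve`. [cite: Hofer–Wysocki–Zehnder
doi:10.2307/121043, doi:10.1215/S0012-7094-95-08111-5; Wendl doi:10.1215/00127094-2010-021;
Taubes doi:10.2140/gt.2006.10.785; Gabai doi:10.4310/jdg/1214441485; Gompf–Scharlemann–Thompson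
doi:10.2140/gt.2010.14.2305; Smale doi:10.1090/S0002-9939-1959-0112149-8] -/
theorem stub_foliationRecognition :
    ∀ (S : HomotopySphere 4) (p : S.carrier)
      (ε δ : ℝ) (sf : MForm (𝓡 4) ↥(punctured p) ℝ 2) (Ψ₁ Ψ₂ : EuclideanSpace ℝ (Fin 4) → ↥(punctured p))
      (J : ∀ x : ↥(punctured p), TangentSpace (𝓡 4) x →L[ℝ] TangentSpace (𝓡 4) x) (π : ↥(punctured p) → ℂ),
      IsNearSymplecticData p ε δ sf Ψ₁ Ψ₂ → IsPinnedStructure p ε δ sf Ψ₁ Ψ₂ J →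
      IsTransparentFoliation p ε Ψ₁ Ψ₂ J π →
      (∀ (u : ℂ → ↥(punctured p)) (U : Set ℂ) (t : ℂ), IsOpen U → Set.InjOn u U →
          ContMDiffOn 𝓘(ℝ, ℂ) (𝓡 4) ∞ u U →
          (∀ z ∈ U, ∀ ζ : ℂ, mfderiv 𝓘(ℝ, ℂ) (𝓡 4) u z (Complex.I * ζ : ℂ) =
            J (u z) (mfderiv 𝓘(ℝ, ℂ) (𝓡 4) u z (ζ : ℂ))) →
          u '' U ⊆ π ⁻¹' {t} ∩ (Ψ₁ '' taubesCore ∪ Ψ₂ '' taubesCore)ᶜ →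
          MeasureTheory.IntegrableOn
            (fun z : ℂ => sf (u z) ![mfderiv 𝓘(ℝ, ℂ) (𝓡 4) u z (1 : ℂ), mfderiv 𝓘(ℝ, ℂ) (𝓡 4) u z Complex.I])
            (U ∩ u ⁻¹' (Ψ₁ '' taubesTube δ ∪ Ψ₂ '' taubesTube δ))) →
      ∃ Φ : (punctured p) ≃ₘ⟮𝓡 4, 𝓡 4⟯ EuclideanSpace ℝ (Fin 4), AgreesWithInvertedChartNear p ⇑Φ := by
  sorry

/-- **Composition (kernel-checked, no `sorry` of its own).**  The five stubs BY NAME imply the crux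
`Summit.SmoothPoincare4.SmoothPoincare4.Theses.SullivanDual.HyperbolicEnd`: at `(S, p)` take the
near-symplectic data of `stub_nearSymplecticData`; feed `stub_pencilFoliation` with
`stub_noWitnessOffDefect`, `stub_modelFoliation` and the data to get data, `J` and a transparent
planar `J`-foliation `π` of `(Σ ∖ p) ∖ Z`; `stub_foliationRecognition` turns them into
`Φ : Σ ∖ p ≃ₘ ℝ⁴` agreeing with the inverted chart; the landed glue
`Literature.Geometry.Symplectic.sympcap_glue_chartStandardEnd` (item 0443) extends it over `p` to
`Σ ≅ S⁴`, and the landed `Cruxes.HyperbolicEnd.Sketch.hyperbolicEndAt_of_nonempty_diffeomorph_sphere`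
(SPC4Case p113806) pulls back the model hyperbolic pair: the crux's clauses hold at `(S, p)` with
`J_hyp = Φ*i`. -/
theorem HyperbolicEnd_of :
    Summit.SmoothPoincare4.SmoothPoincare4.Theses.SullivanDual.HyperbolicEnd := by
  intro S p
  -- Σ-blind existence input (S1): near-symplectic data with two Taubes tubes on `Σ ∖ p`
  -- (closed modulo `relNearSymplecticTaubesTubes_exists` by the landed staging helper)
  have hdata := stub_nearSymplecticData S p
  -- the apex (S3), fed with the LANDED first lemma (S2, tree theorem), the model (SM) and the data:
  -- data, a pinned `J` and a transparent finite-energy foliation of `(Σ ∖ p) ∖ Z`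
  obtain ⟨ε, δ, sf, Ψ₁, Ψ₂, J, π, hD, hJ, hF, hE⟩ :=
    stub_pencilFoliation stub_noWitnessOffDefect stub_modelFoliation S p hdata
  -- end-game (S4): recognition of the finite-energy foliated end gives the chart form
  obtain ⟨Φ, hΦ⟩ := stub_foliationRecognition S p ε δ sf Ψ₁ Ψ₂ J π hD hJ hF hE
  -- landed: glue over `p` (item 0443) and pull back the model hyperbolic pair (SPC4Case, p113806)
  exact Summit.SmoothPoincare4.SmoothPoincare4.Cruxes.HyperbolicEnd.Sketch.hyperbolicEndAt_of_nonempty_diffeomorph_sphere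
    S p (sympcap_glue_chartStandardEnd S p Φ hΦ)

end Summit.SmoothPoincare4.SmoothPoincare4.Cruxes.HyperbolicEnd.TaubesCirclePencil

end
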